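import Literature.NumberTheory.Transcendental.LineODETheta
import HarnessLib

/-!
# The line generators of `M_κ` are affine coordinates: algebraic values at algebraic points

Topic: `Literature/NumberTheory/Transcendental`. Plan item W4 ("LineODE", part 3) of the unit
`provefact-Literature.NumberTheory.Transcendental.H-b596640137`. The generators `genFun` of
`LineODEGens.lean` were chosen so that each of them IS one of the affine chart coordinates
`A_J = Θ_J/Θ_{J₀(c)}` of `M_κ` (`LineJetsBasic.lean`, `LineODETheta.lean`):
`E_j = A_{(j,(M₀,−))}`, `℘_b`/`u_b` and `℘′_b`/`p_b` `= A_{(−,(M₀[b ↦ k],−))}`, and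
`Ñ_e = A_{(−,(M₀,e))}` (`genFun_zero_eq_chartCoord`). Consequently (`genFun_zero_mem_Kbar`), at a
point `w ∈ GaGmE.Std.Alg L κ` (exponential algebraic) and for a chart choice valid at `w`, ALL
generator values are algebraic numbers (`PkappaThetaPoints.exists_theta_div_mem_Kbar`) — the input
of the Siegel and Liouville steps of Baker's method, where the jets `D_x^k(P∘HPoly)(genFun(0))`
(`LineODETheta.vanishesAlong_thetaEval_iff_der`) must be algebraic numbers of controlled size and
denominator. Everything here is proved.

## References

* A. Baker, G. Wüstholz, *Logarithmic Forms and Diophantine Geometry*, CUP 2007, §6.8 (p. 119).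
-/

noncomputable section

open Complex MvPolynomial
open scoped PeriodPair

namespace Literature.NumberTheory.Transcendental

namespace GaGmE

namespace Std

variable {β γ δ : Type} [Fintype β] [Fintype γ] [Fintype δ] [DecidableEq γ]
variable {L : PeriodPair} (κM : δ → γ → Kbar)

/-! ### Chart coordinates at algebraic points are algebraic -/

omit [Fintype β] [Fintype δ] in
/-- At `w ∈ Alg` every affine chart coordinate `Θ_J(w)/Θ_{J₀}(w)` is an algebraic number (also,
trivially, in the degenerate case `Θ_{J₀}(w) = 0` where it is the junk value `0`).
[cite: BakerWustholz2007, §6.8 (p. 119)] -/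
theorem chartCoord_mem_Kbar (h₂ : IsAlgebraic ℚ L.g₂) (h₃ : IsAlgebraic ℚ L.g₃)
    {w : β ⊕ (γ ⊕ δ) → ℂ} (hw : w ∈ Alg L κM) (J₀ J : Option β × ThetaIdx γ δ) :
    chartCoord L κM J₀ J w ∈ algebraicClosure ℚ ℂ := by
  obtain ⟨J₁, hJ₁, halg⟩ := exists_theta_div_mem_Kbar (β := β) h₂ h₃ κM hw
  have e : chartCoord L κM J₀ J w =
      (theta L κM J w / theta L κM J₁ w) / (theta L κM J₀ w / theta L κM J₁ w) := by
    rw [chartCoord, div_div_div_cancel_right₀ hJ₁]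
  rw [e]
  exact div_mem (halg J) (halg J₀)

/-! ### The generators are chart coordinates -/

/-- The block index of the `i`-th factor generator: generic `(℘, ℘′) = (P₁, P₂)/P₀`, origin chart
`(u, p) = (P₀, P₁)/P₂`. [folklore] -/
def genFin (lat : Bool) (i : Fin 2) : Fin 3 := if lat then i.castSucc else i.succ

/-- The projective index `J(i)` with `genFun(0) i = A_{J(i)}(w)`. [folklore] -/
def genIdx (c : γ → Bool) : Gen β γ δ → Option β × ThetaIdx γ δ
  | Sum.inl j => (some j, (fun b => baseFin (c b), none))
  | Sum.inr (Sum.inl (b, i)) =>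
      (none, (Function.update (fun b' => baseFin (c b')) b (genFin (c b) i), none))
  | Sum.inr (Sum.inr e) => (none, (fun b => baseFin (c b), some e))

/-- `rVal` at the base index is `1`. [folklore] -/
@[simp] theorem rVal_baseFin (lat : Bool) (z : ℂ) : rVal L lat (baseFin lat) z = 1 := by
  cases lat <;> simp [rVal, baseFin]

/-- `corrVal` at the base index is `0`. [folklore] -/
@[simp] theorem corrVal_baseFin (lat : Bool) (z : ℂ) : corrVal L lat (baseFin lat) z = 0 := by
  cases lat <;> simp [corrVal, baseFin]

/-- `rVal` at the generator index is the generator. [folklore] -/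
@[simp] theorem rVal_genFin (lat : Bool) (i : Fin 2) (z : ℂ) :
    rVal L lat (genFin lat i) z = factorGen L lat i z := by
  cases lat <;> fin_cases i <;> simp [rVal, genFin, factorGen]

omit [Fintype β] [Fintype δ] in
/-- **The generators are chart coordinates**: for a chart choice valid at `w` (along `x`, at
`ξ = 0`), `genFun(0) i = A_{J(i)}(w)`. [folklore] -/
theorem genFun_zero_eq_chartCoord (c : γ → Bool) (w x : β ⊕ (γ ⊕ δ) → ℂ)
    (hc : (0 : ℂ) ∈ chartDomain L c w x) (i : Gen β γ δ) :
    genFun L κM c w x 0 i = chartCoord L κM (baseIdx c) (genIdx c i) w := by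
  have key := chartCoord_baseIdx_eq_eval κM c w x hc (genIdx c i)
  simp only [zero_smul, add_zero] at key
  rw [key]
  -- evaluate `HPoly (genIdx c i)` at the generators
  have er : ∀ (b : γ) (k : Fin 3), MvPolynomial.eval (genFun L κM c w x 0) (rPoly (c b) b k) =
      rVal L (c b) k (w (iz b)) := fun b k => by
    rw [eval_rPoly]; simp
  rcases i with j | ⟨b, i⟩ | e
  · -- torus
    simp [genIdx, HPoly, TPoly, genFun, er]
  · -- factor generator
    simp only [genIdx, HPoly, TPoly, one_mul, map_prod, er]
    rw [Finset.prod_eq_single b]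
    · simp [genFun]
    · intro b' _ hb'
      rw [Function.update_of_ne hb', rVal_baseFin]
    · intro h; exact absurd (Finset.mem_univ b) h
  · -- fibre generator
    have ec : ∀ b, MvPolynomial.eval (genFun L κM c w x 0) (corrPoly L (c b) b (baseFin (c b))) = 0 :=
      fun b => by rw [eval_corrPoly]; simp
    simp [genIdx, HPoly, TPoly, er, ec]

omit [Fintype β] [Fintype δ] in
/-- The base theta function does not vanish at a point with a valid chart choice. [folklore] -/
theorem theta_baseIdx_ne_zero (c : γ → Bool) {w x : β ⊕ (γ ⊕ δ) → ℂ}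
    (hc : (0 : ℂ) ∈ chartDomain L c w x) : theta L κM (baseIdx c) w ≠ 0 := by
  rw [theta_baseIdx]
  refine Finset.prod_ne_zero_iff.mpr fun b _ => ?_
  have hv := hc b
  simp only [zero_mul, add_zero] at hv
  exact (factor_blocks (c b) hv 0).1

omit [Fintype β] [Fintype δ] in
/-- **All generator values at an algebraic point are algebraic numbers.** For `w ∈ Alg L κ`,
`g₂, g₃ ∈ ℚ̄` and a chart choice valid at `w`: `genFun(0) i ∈ ℚ̄` for every `i`.
[cite: BakerWustholz2007, §6.8 (p. 119: `f_i(sv) = ϱX_i(sγ)` with `X_i(sγ)` algebraic)] -/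
theorem genFun_zero_mem_Kbar (h₂ : IsAlgebraic ℚ L.g₂) (h₃ : IsAlgebraic ℚ L.g₃) (c : γ → Bool)
    {w : β ⊕ (γ ⊕ δ) → ℂ} (hw : w ∈ Alg L κM) (x : β ⊕ (γ ⊕ δ) → ℂ)
    (hc : (0 : ℂ) ∈ chartDomain L c w x) (i : Gen β γ δ) :
    genFun L κM c w x 0 i ∈ algebraicClosure ℚ ℂ := by
  rw [genFun_zero_eq_chartCoord κM c w x hc i]
  exact chartCoord_mem_Kbar κM h₂ h₃ hw _ _

omit [Fintype β] [Fintype δ] in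
/-- The same, as `IsAlgebraic`. [folklore] -/
theorem isAlgebraic_genFun_zero (h₂ : IsAlgebraic ℚ L.g₂) (h₃ : IsAlgebraic ℚ L.g₃) (c : γ → Bool)
    {w : β ⊕ (γ ⊕ δ) → ℂ} (hw : w ∈ Alg L κM) (x : β ⊕ (γ ⊕ δ) → ℂ)
    (hc : (0 : ℂ) ∈ chartDomain L c w x) (i : Gen β γ δ) :
    IsAlgebraic ℚ (genFun L κM c w x 0 i) :=
  mem_algebraicClosure_iff.mp (genFun_zero_mem_Kbar κM h₂ h₃ c hw x hc i)

end Std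

end GaGmE

end Literature.NumberTheory.Transcendental

end
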